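import Summits.FinalStateConjecture.FinalStateConjecture.Theorems.PhotonSphereChannelsTameHullDefs
import Literature.Geometry.Lorentzian.MultiCentreRadiationZone
import HarnessLib

/-!
# Route PhotonSphereChannels · crux `ChannelsResolveTameDevelopmentsR` · line `dark-future-exactness`
# Glue G0: the far deviation of a tame end is `C^∞` on the open far cylinder

For an end datum `E` of a spacetime `𝓢` which is a `(Λ, r₀)`-tame end (`TameHull.EndDatum.IsTameEnd`),
the far deviation `E.h = far^* g − g_{M,0}` (the extension by zero
`𝓢.deviationExtend E.B E.far` of `Spacetime.deviation` on the far background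
`E.B = farBackground E.M E.R`, domain `Kerr.region 0 E.R = ℝ × {r > max R 0}`) is `C^∞` at every
point of the cylinder. This is the smoothness hypothesis of the landed all-orders non-radiation
lemma `isNonRadiating_allOrders` (G1), discharged here from the tameness clauses alone.

Proof (adapted from `Spacetime.contDiffAt_deviationExtend_kerr`, KerrConvergenceProofs.lean, via its
background-generic form `Spacetime.contDiffAt_deviationExtend_model`, MultiCentreRadiationZone.lean):
the far chart is a `C^∞` local diffeomorphism of the cylinder (`IsTameEnd.far_isLocalDiffeomorph`),
hence `C^∞` (`IsLocalDiffeomorph.contMDiff`); the pullback `far^* g` is then a smooth section of the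
bundle of bilinear forms over the open submanifold `Kerr.region 0 E.R ⊆ E4`, i.e. its components are
smooth, and the reference components `x ↦ Kerr.bilin E.M 0 x` (Schwarzschild in ingoing Kerr–Schild
form) are smooth wherever `r > 0` (`Kerr.contDiffAt_bilin`), in particular on the cylinder
(`Kerr.radius_pos_of_mem_region`). Mathlib + the tree's `contDiffAt_deviationExtend_model` and
`Kerr.contDiffAt_bilin` only; the instance hypothesis `[Kerr.Facts]` of the registered signature is
not used by the proof.
-/

noncomputable section

-- the operator-norm instance on `E4 →L[ℝ] E4 →L[ℝ] ℝ` needs one more level of pending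
-- instance problems than the default (as in `TameHullDefs`)
set_option maxSynthPendingDepth 3
-- every `Summit.FinalStateConjecture.FinalStateConjecture.…` name repeats the summit segment (D-0017 layout)
set_option linter.dupNamespace false

open Set Filter Function TopologicalSpace Manifold Bundle
open scoped Topology Manifold ContDiff ENNReal NNReal

namespace Summit.FinalStateConjecture.FinalStateConjecture.Theorems.TameHull

open Literature.Geometry.Lorentzian

/-- The far deviation `E.h = far^* g − g_{M,0}` of an end datum whose far chart is `C^∞` is `C^∞` at
every point of the far cylinder `Kerr.region 0 E.R`: the pullback `far^* g` is a smooth section of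
the bundle of bilinear forms over the open subset `Kerr.region 0 E.R ⊆ E4`
(`Spacetime.contDiffAt_deviationExtend_model`, O'Neill 1983, Ch. 3, Lemma 3.35 ff.), and the
Schwarzschild Kerr–Schild components `Kerr.bilin E.M 0` are smooth on `{r > 0} ⊇ Kerr.region 0 E.R`
(`Kerr.contDiffAt_bilin`, Kerr–Schild 1965, §3). [cite: ONeill1983, Ch. 3, Lemma 3.35] -/
theorem EndDatum.contDiffAt_h_of_contMDiff_far {𝓢 : Spacetime.{0} 4} (E : EndDatum 𝓢)
    (hfar : ContMDiff 𝓘(ℝ, E4) (𝓡 4) ∞ E.far) (x : Kerr.region (0 : ℝ) E.R) :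
    ContDiffAt ℝ ∞ E.h x.1 :=
  -- adapted from `Spacetime.contDiffAt_deviationExtend_kerr` (KerrConvergenceProofs.lean): the
  -- far background `E.B = ⟨Kerr.region 0 E.R, Kerr.bilin E.M 0, (· 0), Kerr.radius 0⟩` replaces
  -- `Kerr.background M a`, by `rfl` on `E.h`, `E.B.domain` and `E.B.bilin`
  𝓢.contDiffAt_deviationExtend_model E.B hfar x
    (Kerr.contDiffAt_bilin E.M 0 (Kerr.radius_pos_of_mem_region x.2))

end Summit.FinalStateConjecture.FinalStateConjecture.Theorems.TameHull

namespace Summit.FinalStateConjecture.FinalStateConjecture.Theorems.DarkFuture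

open Literature.Geometry.Lorentzian
open Summit.FinalStateConjecture.FinalStateConjecture.Theorems.TameHull

/-- **Glue G0 (line `dark-future-exactness`): the far deviation of a tame end is `C^∞` on the open
far cylinder.** For a `(Λ, r₀)`-tame end `E` of a spacetime `𝓢` (`TameHull.EndDatum.IsTameEnd`: in
particular the eternal far chart `E.far : Kerr.region 0 E.R → 𝓢` is a `C^∞` local diffeomorphism,
`IsTameEnd.far_isLocalDiffeomorph`), the far deviation `E.h = far^* g − g_{M,0}` (extended by zero
off the cylinder) is `C^∞` at every point of the cylinder `Kerr.region 0 E.R = ℝ × {r > max R 0}`: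
a local diffeomorphism is `C^∞` (`IsLocalDiffeomorph.contMDiff`), so
`EndDatum.contDiffAt_h_of_contMDiff_far` applies (O'Neill 1983, Ch. 3, Lemma 3.35 ff.: pullbacks of
metric tensors along smooth maps are smooth; Anderson 2004, Def. 1.1 for the tame-end frame).
[cite: ONeill1983, Ch. 3, Lemma 3.35] -/
theorem contDiffAt_farDeviation_of_isTameEnd : ∀ {𝓢 : Spacetime.{0} 4} [Kerr.Facts] (E : EndDatum 𝓢) (Λ : ℝ≥0) (r₀ : ℝ), E.IsTameEnd Λ r₀ → ∀ x : Kerr.region (0 : ℝ) E.R, ContDiffAt ℝ ∞ E.h x.1 := by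
  intro 𝓢 _ E Λ r₀ hE x
  exact E.contDiffAt_h_of_contMDiff_far hE.far_isLocalDiffeomorph.contMDiff x

end Summit.FinalStateConjecture.FinalStateConjecture.Theorems.DarkFuture

end
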